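import Literature.Algebra.Module.FreeOfFibreRankEq
import Mathlib.RingTheory.Spectrum.Prime.Module
import Mathlib.RingTheory.LocalRing.ResidueField.Ideal
import Mathlib.RingTheory.LocalRing.Module
import Mathlib.RingTheory.LocalProperties.Projective
import Mathlib.RingTheory.Localization.BaseChange
import Mathlib.RingTheory.Localization.LocalizationLocalization
import Mathlib.Algebra.Module.FinitePresentation
import Mathlib.LinearAlgebra.TensorProduct.RightExactness
import HarnessLib

/-!
# Upper semicontinuity of the fibre rank of a finite module, and projectivity from constant fibre rank
# (Görtz–Wedhorn I, Cor. 7.31; Hartshorne II, Ex. 5.8 (a), (c); Mumford, *Abelian Varieties*, §5)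

Topic `Algebra/Module`; namespace `Literature.Algebra.Module`; a *proofs* file (theorems only; Mathlib +
★ `Algebra/Module/FreeOfFibreRankEq`). For a finite module `M` over a commutative ring `A` and a prime `𝔭`,
the FIBRE RANK is `dim_{κ(𝔭)} (κ(𝔭) ⊗_A M)` with Mathlib's `κ(𝔭) = 𝔭.asIdeal.ResidueField`
(`𝔭 : PrimeSpectrum A`).

* `subsingleton_residueField_tensor_iff_notMem_support` — Nakayama in the fibre form:
  `κ(𝔭) ⊗_A M = 0 ↔ 𝔭 ∉ Supp M` (Mathlib `IsLocalRing.subsingleton_tensorProduct` transported along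
  `κ(𝔭) ⊗_{A_𝔭} M_𝔭 ≅ κ(𝔭) ⊗_A M`, `nonempty_tensor_localizedModule_equiv`);
* `subsingleton_tensor_quotient_of_span_eq_top` / `span_eq_top_of_subsingleton_tensor_quotient` — for
  `q : ι → M`, the `1 ⊗ q i` span `κ ⊗_A M` over the `A`-algebra `κ` iff `κ ⊗_A (M ⧸ ⟨q i⟩) = 0`
  (right exactness of `κ ⊗_A −`, Mathlib `lTensor_exact`);
* **`isOpen_setOf_finrank_residueField_tensor_lt`** / `isClosed_setOf_le_finrank_residueField_tensor` —
  `{𝔭 ; dim_{κ(𝔭)} (κ(𝔭) ⊗ M) < n}` is OPEN (Görtz–Wedhorn I, Cor. 7.31; Hartshorne II, Ex. 5.8 (a)): lift a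
  `κ(𝔭)`-basis made of elementary tensors `1 ⊗ q i`, `𝔭` is off the CLOSED support (Mathlib
  `Module.isClosed_support`) of the finite module `M ⧸ ⟨q i⟩`, and off that support the `1 ⊗ q i` span;
* **`projective_of_finrank_residueField_tensor_eq`** — over a noetherian DOMAIN, constant fibre rank ⇒ `M`
  projective (Hartshorne II, Ex. 5.8 (c)): at each maximal `𝔪` the closed-fibre rank of `M_𝔪` equals the
  generic one (the fibre rank at `(0)`, read in `κ((0)) = Frac A` made an `A_𝔪`-algebra by
  `IsLocalization.lift`), so `M_𝔪` is free by ★ `free_of_finrank_residueField_le`, and projectivity is local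
  (Mathlib `Module.projective_of_localization_maximal`).

Consumed by `Algebra/Module/TwoTermComplexBaseChange` (semicontinuity of `h⁰` and cohomology-and-base-change
in degree `0` for a two-term complex of finite projectives, Mumford §5 Cor. 1–2). Everything is proved; no
named facts. Mathlib searched (pin): `Module.rankAtStalk`, `isLocallyConstant_rankAtStalk` (flat modules only),
`Module.freeLocus`/`isOpen_freeLocus` (finitely presented) — no semicontinuity of fibre ranks of a non-flat
module; used: `Module.support`, `Module.notMem_support_iff`, `Module.isClosed_support`,
`LocalizedModule.equivTensorProduct`, `TensorProduct.AlgebraTensorModule.cancelBaseChange`,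
`exists_linearIndependent'`, `finrank_range_le_card`, `Module.finitePresentation_of_finite`,
`IsFractionRing.isFractionRing_of_isDomain_of_isLocalization`. Cell `hodgecm-mathlib`, SOCKETS-F §3 node N-bc
(B-plan1 (g13)); generic, count-neutral; B-p10 (g9).

## References

* U. Görtz, T. Wedhorn, *Algebraic Geometry I: Schemes*, 2nd ed., Springer Spektrum (2020), Cor. 7.31
  (upper semicontinuity of `x ↦ dim_{κ(x)} 𝓕(x)` for `𝓕` of finite type). [GortzWedhorn2020]
* R. Hartshorne, *Algebraic Geometry*, GTM 52 (1977), II Ex. 5.8 (a), (c). [Hartshorne1977]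
* D. Mumford, *Abelian Varieties*, TIFR Studies in Mathematics 5 (1970), §5, proof of Cor. 2 (p. 50).
  [MumfordAV1970]
* H. Matsumura, *Commutative Ring Theory* (1986), Thm. 2.3 (Nakayama) and §7. [Matsumura1987]
-/

universe u

open TensorProduct Module

noncomputable section

namespace Literature.Algebra.Module

/-! ### §1 Upper semicontinuity of the fibre rank of a finite module (Görtz–Wedhorn I, Cor. 7.31) -/

section FibreRank

variable {A : Type u} [CommRing A] (M : Type u) [AddCommGroup M] [Module A M]

/-- **Nakayama at a prime, fibre form**: for a finite `A`-module `M` and a prime `𝔭`,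
`κ(𝔭) ⊗_A M = 0` iff `𝔭 ∉ Supp M` (i.e. `M_𝔭 = 0`). [folklore] [cite: Matsumura1987, Thm. 2.3 and §7] -/
theorem subsingleton_residueField_tensor_iff_notMem_support [Module.Finite A M] (p : PrimeSpectrum A) :
    Subsingleton (p.asIdeal.ResidueField ⊗[A] M) ↔ p ∉ Module.support A M := by
  rw [Module.notMem_support_iff]
  -- `κ(𝔭) ⊗_A M ≃ κ(𝔭) ⊗_{A_𝔭} (A_𝔭 ⊗_A M) ≃ κ(𝔭) ⊗_{A_𝔭} M_𝔭`
  let e : p.asIdeal.ResidueField ⊗[Localization.AtPrime p.asIdeal]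
      (LocalizedModule p.asIdeal.primeCompl M) ≃ₗ[Localization.AtPrime p.asIdeal]
        p.asIdeal.ResidueField ⊗[A] M :=
    (LinearEquiv.lTensor p.asIdeal.ResidueField
        (LocalizedModule.equivTensorProduct p.asIdeal.primeCompl M)) ≪≫ₗ
      (TensorProduct.AlgebraTensorModule.cancelBaseChange A (Localization.AtPrime p.asIdeal)
        (Localization.AtPrime p.asIdeal) p.asIdeal.ResidueField M)
  rw [← e.toEquiv.subsingleton_congr]
  exact IsLocalRing.subsingleton_tensorProduct (R := Localization.AtPrime p.asIdeal)

variable {M} in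
/-- If `1 ⊗ q i` (`i : ι`) span `κ ⊗_A M` over the `A`-algebra `κ`, then `κ ⊗_A (M ⧸ ⟨q i⟩) = 0`. [folklore] [cite: Matsumura1987, Thm. 2.3 and §7] -/
theorem subsingleton_tensor_quotient_of_span_eq_top {κ : Type u} [CommRing κ] [Algebra A κ]
    {ι : Type*} [Fintype ι] (q : ι → M)
    (h : Submodule.span κ (Set.range fun i => (1 : κ) ⊗ₜ[A] q i) = ⊤) :
    Subsingleton (κ ⊗[A] (M ⧸ LinearMap.range (Fintype.linearCombination A q))) := by
  set N := LinearMap.range (Fintype.linearCombination A q) with hN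
  -- the surjection `κ ⊗ M → κ ⊗ (M ⧸ N)` is zero
  have hzero : (N.mkQ).baseChange κ = 0 := by
    rw [← LinearMap.range_eq_bot, LinearMap.range_eq_map, ← h, Submodule.map_span,
      Submodule.span_eq_bot]
    rintro _ ⟨_, ⟨i, rfl⟩, rfl⟩
    have hqi : q i ∈ N := by
      rw [hN, Fintype.range_linearCombination]; exact Submodule.subset_span ⟨i, rfl⟩
    rw [LinearMap.baseChange_tmul, Submodule.mkQ_apply, (Submodule.Quotient.mk_eq_zero N).2 hqi, tmul_zero]
  have hsurj : Function.Surjective ((N.mkQ).baseChange κ) := by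
    rw [LinearMap.baseChange_eq_ltensor]
    exact LinearMap.lTensor_surjective κ (Submodule.mkQ_surjective N)
  refine ⟨fun x y => ?_⟩
  obtain ⟨x', rfl⟩ := hsurj x
  obtain ⟨y', rfl⟩ := hsurj y
  rw [hzero, LinearMap.zero_apply, LinearMap.zero_apply]

variable {M} in
/-- Conversely, if `κ ⊗_A (M ⧸ ⟨q i⟩) = 0` then the `1 ⊗ q i` span `κ ⊗_A M` over `κ`
(right exactness of `κ ⊗_A −`). [folklore] [cite: Matsumura1987, Thm. 2.3 and §7] -/
theorem span_eq_top_of_subsingleton_tensor_quotient {κ : Type u} [CommRing κ] [Algebra A κ]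
    {ι : Type*} [Fintype ι] (q : ι → M)
    (h : Subsingleton (κ ⊗[A] (M ⧸ LinearMap.range (Fintype.linearCombination A q)))) :
    Submodule.span κ (Set.range fun i => (1 : κ) ⊗ₜ[A] q i) = ⊤ := by
  set φ := Fintype.linearCombination A q with hφ
  -- exactness of `κ ⊗ (ι → A) → κ ⊗ M → κ ⊗ (M ⧸ im φ) = 0`
  have hex := lTensor_exact κ (LinearMap.exact_map_mkQ_range φ) (Submodule.mkQ_surjective _)
  have hker : LinearMap.ker (LinearMap.lTensor κ (LinearMap.range φ).mkQ) = ⊤ := by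
    rw [eq_top_iff]
    intro x _
    exact Subsingleton.elim _ _
  have hrange : LinearMap.range (LinearMap.lTensor κ φ) = ⊤ := by
    rw [← LinearMap.exact_iff.1 hex, hker]
  -- the `κ`-span of the `1 ⊗ q i` contains the range of `φ_κ`
  rw [eq_top_iff]
  rintro x -
  have hx : x ∈ LinearMap.range (φ.baseChange κ) := by
    change x ∈ Set.range (φ.baseChange κ)
    rw [LinearMap.baseChange_eq_ltensor, ← LinearMap.coe_range, hrange]
    trivial
  obtain ⟨y, rfl⟩ := hx
  induction y using TensorProduct.induction_on with
  | zero => rw [map_zero]; exact zero_mem _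
  | add y z hy hz => rw [map_add]; exact add_mem hy hz
  | tmul c v =>
    rw [LinearMap.baseChange_tmul, hφ, Fintype.linearCombination_apply, tmul_sum]
    refine Submodule.sum_mem _ fun i _ => ?_
    have hc : c ⊗ₜ[A] (v i • q i) = (v i • c) • ((1 : κ) ⊗ₜ[A] q i) := by
      rw [smul_tmul', smul_eq_mul, mul_one, smul_tmul]
    rw [hc]
    exact Submodule.smul_mem _ _ (Submodule.subset_span ⟨i, rfl⟩)

/-- **Upper semicontinuity of the fibre rank** (Görtz–Wedhorn I, Cor. 7.31; Hartshorne II, Ex. 5.8 (a)):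
for a finite module `M` over a commutative ring `A` and every `n`, the set of primes `𝔭` with
`dim_{κ(𝔭)} (κ(𝔭) ⊗_A M) < n` is OPEN in `Spec A`. Proof: at `𝔭` pick `r = dim` elements `q i` of `M`
whose images form a `κ(𝔭)`-basis; `κ(𝔭) ⊗ (M ⧸ ⟨q i⟩) = 0`, so `𝔭` lies outside the closed support of the
finite module `M ⧸ ⟨q i⟩`, and at every prime outside that support the `1 ⊗ q i` still span.
[cite: GortzWedhorn2020, Cor. 7.31] -/
theorem isOpen_setOf_finrank_residueField_tensor_lt [Module.Finite A M] (n : ℕ) :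
    IsOpen {p : PrimeSpectrum A |
      finrank p.asIdeal.ResidueField (p.asIdeal.ResidueField ⊗[A] M) < n} := by
  rw [isOpen_iff_forall_mem_open]
  intro p hp
  -- a `κ(𝔭)`-basis of `κ(𝔭) ⊗ M` made of elementary tensors `1 ⊗ q`
  obtain ⟨ι, q, -, hspan, hli⟩ :=
    exists_linearIndependent' (K := p.asIdeal.ResidueField) (fun m : M => (1 : p.asIdeal.ResidueField) ⊗ₜ[A] m)
  have htop : Submodule.span p.asIdeal.ResidueField
      (Set.range fun m : M => (1 : p.asIdeal.ResidueField) ⊗ₜ[A] m) = ⊤ := by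
    have h := Submodule.baseChange_top (R := A) (M := M) (A := p.asIdeal.ResidueField)
    rw [← Submodule.span_univ, Submodule.baseChange_span, Set.image_univ] at h
    exact h
  rw [htop] at hspan
  haveI : Finite ι := hli.finite
  letI : Fintype ι := Fintype.ofFinite ι
  have hcard : Fintype.card ι =
      finrank p.asIdeal.ResidueField (p.asIdeal.ResidueField ⊗[A] M) :=
    (finrank_eq_card_basis (Basis.mk hli (by rw [hspan]))).symm
  -- the quotient by the lifts and its closed support
  set M' := M ⧸ LinearMap.range (Fintype.linearCombination A (fun i => q i)) with hM'
  have hp' : p ∉ Module.support A M' :=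
    (subsingleton_residueField_tensor_iff_notMem_support M' p).1
      (subsingleton_tensor_quotient_of_span_eq_top (fun i => q i) hspan)
  refine ⟨(Module.support A M')ᶜ, fun p' hp'' => ?_, Module.isClosed_support.isOpen_compl, hp'⟩
  -- at a prime outside the support the `1 ⊗ q i` span, so the fibre rank is `≤ #ι < n`
  have hsub : Subsingleton (p'.asIdeal.ResidueField ⊗[A] M') :=
    (subsingleton_residueField_tensor_iff_notMem_support M' p').2 hp''
  have hsp := span_eq_top_of_subsingleton_tensor_quotient (κ := p'.asIdeal.ResidueField) (fun i => q i) hsub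
  change finrank _ _ < n
  calc finrank p'.asIdeal.ResidueField (p'.asIdeal.ResidueField ⊗[A] M)
      = finrank p'.asIdeal.ResidueField (Submodule.span p'.asIdeal.ResidueField
          (Set.range fun i => (1 : p'.asIdeal.ResidueField) ⊗ₜ[A] q i)) := by rw [hsp, finrank_top]
    _ ≤ Fintype.card ι := finrank_range_le_card _
    _ < n := by rw [hcard]; exact hp

/-- The closed form: `{𝔭 ; n ≤ dim_{κ(𝔭)} (κ(𝔭) ⊗_A M)}` is closed. [cite: GortzWedhorn2020, Cor. 7.31] -/
theorem isClosed_setOf_le_finrank_residueField_tensor [Module.Finite A M] (n : ℕ) :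
    IsClosed {p : PrimeSpectrum A |
      n ≤ finrank p.asIdeal.ResidueField (p.asIdeal.ResidueField ⊗[A] M)} := by
  have h : {p : PrimeSpectrum A | n ≤ finrank p.asIdeal.ResidueField (p.asIdeal.ResidueField ⊗[A] M)} =
      {p | finrank p.asIdeal.ResidueField (p.asIdeal.ResidueField ⊗[A] M) < n}ᶜ := by
    ext p; simp only [Set.mem_setOf_eq, Set.mem_compl_iff, not_lt]
  rw [h]
  exact (isOpen_setOf_finrank_residueField_tensor_lt M n).isClosed_compl

/-- `L ⊗_{A_S} M_S ≃ₗ[L] L ⊗_A M` for an `A_S`-algebra `L` (localisation is a base change, and base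
changes compose). [folklore] [cite: Matsumura1987, Thm. 2.3 and §7] -/
theorem nonempty_tensor_localizedModule_equiv (S : Submonoid A) (L : Type u) [CommRing L] [Algebra A L]
    [Algebra (Localization S) L] [IsScalarTower A (Localization S) L] :
    Nonempty (L ⊗[Localization S] LocalizedModule S M ≃ₗ[L] L ⊗[A] M) :=
  ⟨(LocalizedModule.equivTensorProduct S M).baseChange (Localization S) L _ _ ≪≫ₗ
    TensorProduct.AlgebraTensorModule.cancelBaseChange A (Localization S) L L M⟩

/-- **Constant fibre rank over an integral noetherian base ⇒ projective** (Hartshorne II, Ex. 5.8 (c);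
Mumford, *Abelian Varieties*, §5, proof of Cor. 2): a finite module `M` over a noetherian DOMAIN `A`
all of whose fibre ranks `dim_{κ(𝔭)} (κ(𝔭) ⊗_A M)` are equal is projective (= finite locally free).
At each maximal `𝔪` the closed-fibre rank of `M_𝔪` equals the generic rank (the fibre rank at `(0)`),
so `M_𝔪` is free by ★ `free_of_finrank_residueField_le`, and projectivity is local
(`Module.projective_of_localization_maximal`). [cite: MumfordAV1970, §5 Cor. 2 (p. 50)]
[cite: Hartshorne1977, II Ex. 5.8 (c)] -/
theorem projective_of_finrank_residueField_tensor_eq [IsDomain A] [IsNoetherianRing A] [Module.Finite A M]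
    (r : ℕ) (h : ∀ p : PrimeSpectrum A,
      finrank p.asIdeal.ResidueField (p.asIdeal.ResidueField ⊗[A] M) = r) :
    Module.Projective A M := by
  haveI := Module.finitePresentation_of_finite A M
  apply Module.projective_of_localization_maximal
  intro m hm
  haveI : m.IsPrime := hm.isPrime
  -- the generic point `K = κ((0))`, an `A_𝔪`-algebra and a fraction field of `A_𝔪`
  have hunit : ∀ y : m.primeCompl, IsUnit (algebraMap A (⊥ : Ideal A).ResidueField y) := by
    intro y
    refine isUnit_iff_ne_zero.2 fun h0 => y.2 ?_
    rw [map_eq_zero_iff _ (IsFractionRing.injective A (⊥ : Ideal A).ResidueField)] at h0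
    rw [h0]
    exact m.zero_mem
  letI : Algebra (Localization.AtPrime m) (⊥ : Ideal A).ResidueField :=
    (IsLocalization.lift (M := m.primeCompl) hunit).toAlgebra
  haveI : IsScalarTower A (Localization.AtPrime m) (⊥ : Ideal A).ResidueField :=
    IsScalarTower.of_algebraMap_eq fun x => (IsLocalization.lift_eq hunit x).symm
  haveI : IsFractionRing (Localization.AtPrime m) (⊥ : Ideal A).ResidueField :=
    IsFractionRing.isFractionRing_of_isDomain_of_isLocalization m.primeCompl _ _
  obtain ⟨eκ⟩ := nonempty_tensor_localizedModule_equiv M m.primeCompl m.ResidueField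
  obtain ⟨eK⟩ := nonempty_tensor_localizedModule_equiv M m.primeCompl (⊥ : Ideal A).ResidueField
  have h1 : finrank (IsLocalRing.ResidueField (Localization.AtPrime m))
      (IsLocalRing.ResidueField (Localization.AtPrime m) ⊗[Localization.AtPrime m]
        LocalizedModule m.primeCompl M) = r :=
    eκ.finrank_eq.trans (h ⟨m, hm.isPrime⟩)
  have h2 : finrank (⊥ : Ideal A).ResidueField
      ((⊥ : Ideal A).ResidueField ⊗[Localization.AtPrime m] LocalizedModule m.primeCompl M) = r :=
    eK.finrank_eq.trans (h ⟨⊥, Ideal.isPrime_bot⟩)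
  haveI := free_of_finrank_residueField_le (Localization.AtPrime m) (LocalizedModule m.primeCompl M)
    (⊥ : Ideal A).ResidueField (h1.trans h2.symm).le
  infer_instance

end FibreRank

end Literature.Algebra.Module

end
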